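import Summits.BirchSwinnertonDyer.BirchSwinnertonDyer.Theorems.ErratumRoadFiveRegCertKernelFiveSplitChecker
import HarnessLib

/-!
# Route `ErratumRoadFive` (rung K2, `p ≥ 5`), crux `RamNoErratumDataAtFive` (item stmt-BirchSwinnertonDyer-19624, REST‴):
# the generic first-order SPLIT checker at depth one, part B — `log₅ q_E` and the correction term `T₂` to one digit,
# `heightSplitCoord ≠ 0`, `RegMult.CertSplit W 5 Q 1`, and both halves of `ClassClosure.RegulatorNonvanishingAt W 5` modulo GZK
# (cell `bsd-stepL`, OWNER seat `bsd-stepL-rest-p2` g7; `--supports stmt-BirchSwinnertonDyer-19624`)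

HONEST FRAMING: BSD is not proved by any of this; nothing here closes the crux; Schneider's non-degeneracy conjecture (barrier
`Literature.Barriers.BirchSwinnertonDyer.PAdicHeightNondegeneracy`) is asserted NOWHERE; every application is ONE curve. Continuation of
`Theorems/ErratumRoadFiveRegCertKernelFiveSplitChecker.lean` (same seat): for a SPLIT multiplicative `5` with `v₅(Δ) = δ ≥ 2` THE Tate
parameter satisfies `q_E = 5^δ·u`, `u ≡ u₀ = Δ'/c₄³ (mod 5^δ)` (ATAEC V.5.1: `‖q − 1/j‖ ≤ ‖q‖²`), so `log₅ q_E = 4⁻¹(u⁴ − 1) + O(5⁻²) ≡ 5μ`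
with `25 ∣ (Δ'⁴ − c₄¹²) − 20c₄¹²μ`; the correction term `T₂ = w/log₅ q_E` (`w ≡ 25λ²/Γ`) is `≡ 5τ₂`, `5 ∣ Γμτ₂ − λ²` (case `5 ∤ μ`);
with §2's `T₁ ≡ 5τ₁` the modified height `T₁ − T₂` is non-zero as soon as **`5 ∤ τ₁ − τ₂`**. Theorems only (0 defs, 0 facts); route-free.

* §3 `norm_padicLog_tateParam_sub_le_of_congr`; §4 `norm_correction_sub_le_depthOne`; §5 `heightSplitCoord_ne_zero_of_certDepthOne`,
  `certSplit_of_certDepthOne`, `regulatorNonvanishingAt_of_certs_of_GZK`.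

References: [SteinWuthrich2013] §4.2 (p. 16); [SilvermanATAEC1994] V.3.1, Lemma V.5.1; [Iwasawa1972PadicL] §4.4; [MazurSteinTate2006] §1;
[KolyvaginEulerSystems1990] Thm. A (GZK).
-/

open scoped Classical

open Filter Topology PowerSeries IsUltrametricDist WeierstrassCurve Literature.NumberTheory.EllipticCurves
  Literature.NumberTheory.EllipticCurves.Rank1Residual
  Literature.NumberTheory.EllipticCurves.SteinWuthrich2013
  Summit.BirchSwinnertonDyer.Rank1Residual
  Summit.BirchSwinnertonDyer.Rank1Residual.X11b

namespace Summit.BirchSwinnertonDyer.Rank1Residual.X11b.RegMult.KernelCertFive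

/-! ### §0 Plumbing in `ℚ₅` -/

/-- Ultrametric inequality for differences. [folklore] -/
private theorem norm_sub_le_max₅' (a b : ℚ_[5]) : ‖a - b‖ ≤ max ‖a‖ ‖b‖ := by
  rw [sub_eq_add_neg, ← norm_neg b]; exact IsUltrametricDist.norm_add_le_max a (-b)

/-- `‖5^k‖₅ = 1/5^k`. [folklore] -/
private theorem norm_five_pow₅' (k : ℕ) : ‖(5 : ℚ_[5]) ^ k‖ = 1 / (5 : ℝ) ^ k := by
  rw [norm_pow, show (5 : ℚ_[5]) = ((5 : ℕ) : ℚ_[5]) by norm_cast, Padic.norm_p]; simp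

/-- `‖5‖₅ = 5⁻¹`. [folklore] -/
private theorem norm_five₅' : ‖(5 : ℚ_[5])‖ = 1 / 5 := by
  rw [show (5 : ℚ_[5]) = (5 : ℚ_[5]) ^ 1 by norm_num, norm_five_pow₅']; norm_num

/-- `‖25‖₅ = 5⁻²`. [folklore] -/
private theorem norm_twentyfive₅' : ‖(25 : ℚ_[5])‖ = 1 / 25 := by
  rw [show (25 : ℚ_[5]) = (5 : ℚ_[5]) ^ 2 by norm_num, norm_five_pow₅']; norm_num

/-- `‖(4 : ℚ₅)⁻¹‖ = 1`. [folklore] -/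
private theorem norm_inv_four₅' : ‖(4 : ℚ_[5])⁻¹‖ = 1 := by
  rw [norm_inv, show (4 : ℚ_[5]) = ((4 : ℤ) : ℚ_[5]) by norm_cast, norm_intCast_eq_one_of_not_dvd (by decide), inv_one]

/-- `‖u⁴ − v⁴‖ ≤ ‖u − v‖` for `‖u‖, ‖v‖ ≤ 1`. [folklore] -/
private theorem norm_pow_four_sub_le₅' {u v : ℚ_[5]} (hu : ‖u‖ ≤ 1) (hv : ‖v‖ ≤ 1) : ‖u ^ 4 - v ^ 4‖ ≤ ‖u - v‖ := by
  have hid : u ^ 4 - v ^ 4 = (u - v) * ((u + v) * (u ^ 2 + v ^ 2)) := by ring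
  rw [hid, norm_mul, norm_mul]
  have h1 : ‖u + v‖ ≤ 1 := (IsUltrametricDist.norm_add_le_max _ _).trans (max_le hu hv)
  have h2 : ‖u ^ 2 + v ^ 2‖ ≤ 1 := by
    refine (IsUltrametricDist.norm_add_le_max _ _).trans (max_le ?_ ?_)
    · rw [norm_pow]; exact pow_le_one₀ (norm_nonneg _) hu
    · rw [norm_pow]; exact pow_le_one₀ (norm_nonneg _) hv
  calc ‖u - v‖ * (‖u + v‖ * ‖u ^ 2 + v ^ 2‖) ≤ ‖u - v‖ * (1 * 1) := by gcongr
    _ = ‖u - v‖ := by ring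

/-! ### §3 `log₅ q_E` to one digit from the integer model: `‖log₅ q_E − 5μ‖₅ ≤ 5⁻²` -/

/-- **`log₅` of THE Tate parameter to first order, from `j = c₄³/(5^δΔ')` (`δ ≥ 2`, `5 ∤ c₄Δ'`).** For every `q ∈ ℚ₅` with `‖q‖ < 1`
and `j(q) = j(W) = c₄³/(5^δΔ')`: `‖q‖ = 5^{−δ}`, the unit part `u = q·5^{−δ}` satisfies `‖u − Δ'/c₄³‖ ≤ 5^{−δ} ≤ 5⁻²` (ATAEC V.5.1,
`KernelCertFive.norm_tateParam_of_tateJ_eq`), `log₅ q = 4⁻¹(u⁴ − 1) + O(‖1 − u⁴‖²)` (`norm_padicLog_sub_unitPart_le`), and for an integer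
`μ` with `25 ∣ (Δ'⁴ − c₄¹²) − 20c₄¹²μ`: `‖log₅ q − 5μ‖₅ ≤ 5⁻²`; if `5 ∤ μ` then `‖log₅ q‖₅ = 5⁻¹`. [cite: SilvermanATAEC1994, Lemma V.5.1]
[cite: Iwasawa1972PadicL, §4.4] -/
theorem norm_padicLog_tateParam_sub_le_of_congr (W : WeierstrassCurve ℚ) [W.IsElliptic] {c4 Dp μ : ℤ} {δ : ℕ}
    (hj : W.j = ((c4 ^ 3 : ℤ) : ℚ) / ((5 ^ δ * Dp : ℤ) : ℚ)) (hδ : 2 ≤ δ) (h5c4 : ¬ (5 : ℤ) ∣ c4) (h5Dp : ¬ (5 : ℤ) ∣ Dp)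
    (hμ : (25 : ℤ) ∣ (Dp ^ 4 - c4 ^ 12) - 20 * c4 ^ 12 * μ)
    {q : ℚ_[5]} (hq1 : ‖q‖ < 1) (hjq : tateJ q = (W.j : ℚ_[5])) :
    ‖padicLog 5 q - 5 * (μ : ℚ_[5])‖ ≤ 1 / 25 ∧ (¬ (5 : ℤ) ∣ μ → ‖padicLog 5 q‖ = 1 / 5) := by
  have hc4n : ‖(c4 : ℚ_[5])‖ = 1 := norm_intCast_eq_one_of_not_dvd h5c4
  have hDn : ‖(Dp : ℚ_[5])‖ = 1 := norm_intCast_eq_one_of_not_dvd h5Dp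
  have hc40 : (c4 : ℚ_[5]) ≠ 0 := by intro h; rw [h, norm_zero] at hc4n; exact zero_ne_one hc4n
  have hD0 : (Dp : ℚ_[5]) ≠ 0 := by intro h; rw [h, norm_zero] at hDn; exact zero_ne_one hDn
  have h50 : (5 : ℚ_[5]) ^ δ ≠ 0 := pow_ne_zero _ (by norm_num)
  -- `j₀ = c₄³/(5^δ Δ')` in `ℚ₅` and its inverse `5^δ·u₀`
  set u₀ : ℚ_[5] := (Dp : ℚ_[5]) / (c4 : ℚ_[5]) ^ 3 with hu₀def
  have hu₀n : ‖u₀‖ = 1 := by rw [hu₀def, norm_div, norm_pow, hDn, hc4n]; norm_num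
  have hj₀ : (W.j : ℚ_[5]) = (c4 : ℚ_[5]) ^ 3 / ((5 : ℚ_[5]) ^ δ * Dp) := by rw [hj]; push_cast; ring
  have hj₀inv : ((W.j : ℚ_[5]))⁻¹ = (5 : ℚ_[5]) ^ δ * u₀ := by rw [hj₀, hu₀def, inv_div]; field_simp
  have hj₀n : ‖(W.j : ℚ_[5])‖ = (5 : ℝ) ^ δ := by
    rw [hj₀, norm_div, norm_mul, norm_pow, hc4n, norm_five_pow₅', hDn]; field_simp
  obtain ⟨hn, hsub⟩ := norm_tateParam_of_tateJ_eq hq1 hjq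
  have hnq : ‖q‖ = 1 / (5 : ℝ) ^ δ := by rw [hn, hj₀n, one_div]
  have hq0 : q ≠ 0 := by intro h; rw [h, norm_zero] at hnq; exact absurd hnq (by positivity)
  have hval : q.valuation = δ := valuation_eq_of_norm_eq hq0 (n := δ) (by rw [hnq]; norm_num)
  -- the unit part `u = q·5^{−δ}` and `‖u − u₀‖ ≤ 5^{−δ} ≤ 5⁻²`
  set u : ℚ_[5] := q * ((5 : ℕ) : ℚ_[5]) ^ (-(δ : ℤ)) with hudef
  have h5z : ((5 : ℕ) : ℚ_[5]) ^ (-(δ : ℤ)) = ((5 : ℚ_[5]) ^ δ)⁻¹ := by rw [zpow_neg, zpow_natCast]; push_cast; rfl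
  have hun : ‖u‖ = 1 := by
    have h := norm_mul_zpow_neg_valuation hq0
    rwa [hval] at h
  have huu₀ : ‖u - u₀‖ ≤ 1 / 25 := by
    have hid : u - u₀ = (q - ((W.j : ℚ_[5]))⁻¹) * ((5 : ℚ_[5]) ^ δ)⁻¹ := by rw [hudef, h5z, hj₀inv]; field_simp
    rw [hid, norm_mul, norm_inv, norm_five_pow₅']
    calc ‖q - ((W.j : ℚ_[5]))⁻¹‖ * (1 / (5 : ℝ) ^ δ)⁻¹ ≤ ‖q‖ * ‖q‖ * (1 / (5 : ℝ) ^ δ)⁻¹ := by gcongr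
      _ = 1 / (5 : ℝ) ^ δ := by rw [hnq]; field_simp
      _ ≤ 1 / (5 : ℝ) ^ 2 := one_div_le_one_div_of_le (by positivity) (pow_le_pow_right₀ (by norm_num) hδ)
      _ = 1 / 25 := by norm_num
  have hu4 : ‖u ^ 4 - u₀ ^ 4‖ ≤ 1 / 25 := (norm_pow_four_sub_le₅' hun.le hu₀n.le).trans huu₀
  -- `1 − u₀⁴ = (c₄¹² − Δ'⁴)/c₄¹²`, of norm `≤ 5⁻¹`
  have h5d : (5 : ℤ) ∣ Dp ^ 4 - c4 ^ 12 := by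
    have h25 : (5 : ℤ) ∣ (Dp ^ 4 - c4 ^ 12) - 20 * c4 ^ 12 * μ := dvd_trans (by norm_num) hμ
    have h20 : (5 : ℤ) ∣ 20 * c4 ^ 12 * μ := dvd_mul_of_dvd_left (dvd_mul_of_dvd_left (by norm_num) _) _
    simpa using Int.dvd_add h25 h20
  have hu₀4 : u₀ ^ 4 - 1 = (((Dp ^ 4 - c4 ^ 12 : ℤ)) : ℚ_[5]) / (c4 : ℚ_[5]) ^ 12 := by
    rw [hu₀def]; push_cast; field_simp
  have h1u₀ : ‖1 - u₀ ^ 4‖ ≤ 1 / 5 := by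
    rw [← norm_neg, neg_sub, hu₀4, norm_div, norm_pow, hc4n, one_pow, div_one]
    refine ((Padic.norm_int_le_pow_iff_dvd (p := 5) _ 1).mpr (by simpa using h5d)).trans (by norm_num)
  have h1u : ‖1 - u ^ 4‖ ≤ 1 / 5 := by
    have : 1 - u ^ 4 = (1 - u₀ ^ 4) - (u ^ 4 - u₀ ^ 4) := by ring
    rw [this]; exact (norm_sub_le_max₅' _ _).trans (max_le h1u₀ (hu4.trans (by norm_num)))
  -- the logarithm
  have hlog := norm_padicLog_sub_unitPart_le hq0
  rw [hval] at hlog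
  have hlog' : ‖padicLog 5 q - (4 : ℚ_[5])⁻¹ * (u ^ 4 - 1)‖ ≤ 1 / 25 :=
    hlog.trans (by calc ‖1 - u ^ 4‖ ^ 2 ≤ (1 / 5) ^ 2 := by gcongr
                    _ = 1 / 25 := by norm_num)
  have hres : ‖(4 : ℚ_[5])⁻¹ * (u₀ ^ 4 - 1) - 5 * (μ : ℚ_[5])‖ ≤ 1 / 25 := by
    have hid : (4 : ℚ_[5])⁻¹ * (u₀ ^ 4 - 1) - 5 * (μ : ℚ_[5]) =
        (4 : ℚ_[5])⁻¹ * ((((Dp ^ 4 - c4 ^ 12) - 20 * c4 ^ 12 * μ : ℤ) : ℚ_[5]) / (c4 : ℚ_[5]) ^ 12) := by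
      have h40 : (4 : ℚ_[5]) ≠ 0 := by norm_num
      rw [hu₀4]; push_cast; field_simp; ring
    rw [hid, norm_mul, norm_inv_four₅', one_mul, norm_div, norm_pow, hc4n, one_pow, div_one]
    refine ((Padic.norm_int_le_pow_iff_dvd (p := 5) _ 2).mpr (by exact_mod_cast hμ)).trans (by norm_num)
  have hmain : ‖padicLog 5 q - 5 * (μ : ℚ_[5])‖ ≤ 1 / 25 := by
    have hid : padicLog 5 q - 5 * (μ : ℚ_[5]) = (padicLog 5 q - (4 : ℚ_[5])⁻¹ * (u ^ 4 - 1)) +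
        (4 : ℚ_[5])⁻¹ * (u ^ 4 - u₀ ^ 4) + ((4 : ℚ_[5])⁻¹ * (u₀ ^ 4 - 1) - 5 * (μ : ℚ_[5])) := by ring
    rw [hid]
    refine (IsUltrametricDist.norm_add_le_max _ _).trans (max_le ?_ hres)
    refine (IsUltrametricDist.norm_add_le_max _ _).trans (max_le hlog' ?_)
    rw [norm_mul, norm_inv_four₅', one_mul]; exact hu4
  refine ⟨hmain, fun h5μ => ?_⟩
  have hμn : ‖(5 * (μ : ℚ_[5]))‖ = 1 / 5 := by rw [norm_mul, norm_five₅', norm_intCast_eq_one_of_not_dvd h5μ, mul_one]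
  have hlt : ‖padicLog 5 q - 5 * (μ : ℚ_[5])‖ < ‖(5 * (μ : ℚ_[5]))‖ := by rw [hμn]; exact hmain.trans_lt (by norm_num)
  rw [Padic.norm_eq_of_norm_sub_lt_right hlt, hμn]

/-! ### §4 The correction term `T₂ = w/log₅ q_E` to one digit, and §5 the modified height -/

section Split

variable (W : WeierstrassCurve ℚ) {a₁ a₂ a₃ a₄ a₆ : ℤ} (hW : W = ⟨a₁, a₂, a₃, a₄, a₆⟩)
include hW

/-- **`heightSplitCoord W 5 q x y ≠ 0` at THE Tate parameter, from a first-order depth-one SPLIT certificate.** Hypotheses: the depth-one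
data (`c₄, c₆` units, `Q = (a/e², b/e³)`, `e = 5e'`, residue `λ`), `Γ` with `5 ∣ c₄ + Γc₆`, `j(W) = c₄³/(5^δΔ')` with `δ ≥ 2`, `5 ∤ Δ'`,
digits `τ₁` (`25 ∣ (λ⁸ − e'⁸) + 20e'⁸τ₁`), `μ` (`25 ∣ (Δ'⁴ − c₄¹²) − 20c₄¹²μ`, `5 ∤ μ`), `τ₂` (`5 ∣ Γμτ₂ − λ²`), and the certificate
**`5 ∤ τ₁ − τ₂`**. Then for every `q` with `‖q‖ < 1`, `j(q) = j(W)`: `T₁ − T₂ ≠ 0` (`T₁ ≡ 5τ₁`, §2; `w ≡ 25λ²/Γ (mod 5⁻³)`;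
`log₅ q ≡ 5μ`, §3; so `T₂ = w/log₅ q ≡ 5τ₂ (mod 5⁻²)`). [cite: SteinWuthrich2013, §4.2 (p. 16)] [cite: SilvermanATAEC1994, Lemma V.5.1]
[cite: Iwasawa1972PadicL, §4.4] -/
theorem heightSplitCoord_ne_zero_of_certDepthOne [W.IsElliptic] [W.IsGloballyMinimal] {a b c4 c6 lam Γ τ₁ μ τ₂ Dp : ℤ}
    {e' δ : ℕ}
    (hc4 : c4 = (a₁ ^ 2 + 4 * a₂) ^ 2 - 24 * (2 * a₄ + a₁ * a₃))
    (hc6 : c6 = -(a₁ ^ 2 + 4 * a₂) ^ 3 + 36 * (a₁ ^ 2 + 4 * a₂) * (2 * a₄ + a₁ * a₃) - 216 * (a₃ ^ 2 + 4 * a₆))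
    (h5c4 : ¬ (5 : ℤ) ∣ c4) (h5c6 : ¬ (5 : ℤ) ∣ c6) (h5e : ¬ (5 : ℤ) ∣ e') (h5b : ¬ (5 : ℤ) ∣ b)
    (hcop : Nat.Coprime a.natAbs (5 * e'))
    {x y : ℚ} (hx : x = a / ((5 * e' : ℕ) : ℚ) ^ 2) (hy : y = b / ((5 * e' : ℕ) : ℚ) ^ 3)
    (hlam : (25 : ℤ) ∣ -2 * a * e' * b + 5 * a₁ * a ^ 2 * e' ^ 2 - 2 * lam * b ^ 2) (h5lam : ¬ (5 : ℤ) ∣ lam)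
    (hΓ : (5 : ℤ) ∣ c4 + Γ * c6) (hτ₁ : (25 : ℤ) ∣ (lam ^ 8 - (e' : ℤ) ^ 8) + 20 * (e' : ℤ) ^ 8 * τ₁)
    (hj : W.j = ((c4 ^ 3 : ℤ) : ℚ) / ((5 ^ δ * Dp : ℤ) : ℚ)) (hδ : 2 ≤ δ) (h5Dp : ¬ (5 : ℤ) ∣ Dp)
    (hμ : (25 : ℤ) ∣ (Dp ^ 4 - c4 ^ 12) - 20 * c4 ^ 12 * μ) (h5μ : ¬ (5 : ℤ) ∣ μ)
    (hτ₂ : (5 : ℤ) ∣ Γ * μ * τ₂ - lam ^ 2) (hcert : ¬ (5 : ℤ) ∣ τ₁ - τ₂)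
    {q : ℚ_[5]} (hq1 : ‖q‖ < 1) (hjq : tateJ q = (W.j : ℚ_[5])) : heightSplitCoord W 5 q x y ≠ 0 := by
  obtain ⟨hLn, hL2, hC2, -, -⟩ := firstOrderData_depthOne W hW hc4 hc6 h5c4 h5c6 h5e h5b hcop hx hy hlam h5lam hq1
  have hT1 := norm_heightFourOneCoord_sub_le_depthOne W hW hc4 hc6 h5c4 h5c6 h5e h5b hcop hx hy hlam h5lam hτ₁ hq1
  obtain ⟨hlog, hlogn'⟩ := norm_padicLog_tateParam_sub_le_of_congr W hj hδ h5c4 h5Dp hμ hq1 hjq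
  have hlogn := hlogn' h5μ
  set L := (W.baseChange ℚ_[5]).padicFormalLog (-(x : ℚ_[5]) / y) with hLdef
  set C2 := uniformisationScaleSq W 5 q with hC2def
  have hC20 : C2 ≠ 0 := by intro h; rw [h, norm_zero] at hC2; exact zero_ne_one hC2
  have hC2Γ : ‖C2 - Γ‖ ≤ 1 / 5 := norm_uniformisationScaleSq_sub_le_of_congr W hW hc4 hc6 h5c4 h5c6 hΓ hq1
  have h5Γ : ¬ (5 : ℤ) ∣ Γ := by
    intro h
    obtain ⟨k, hk⟩ := hΓ
    obtain ⟨m, hm⟩ := h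
    exact h5c4 ⟨k - m * c6, by linear_combination hk - c6 * hm⟩
  have hΓn : ‖(Γ : ℚ_[5])‖ = 1 := norm_intCast_eq_one_of_not_dvd h5Γ
  have hΓ0 : (Γ : ℚ_[5]) ≠ 0 := by intro h; rw [h, norm_zero] at hΓn; exact zero_ne_one hΓn
  have hμn : ‖(μ : ℚ_[5])‖ = 1 := norm_intCast_eq_one_of_not_dvd h5μ
  have hμ0 : (μ : ℚ_[5]) ≠ 0 := by intro h; rw [h, norm_zero] at hμn; exact zero_ne_one hμn
  have hlamn : ‖(lam : ℚ_[5])‖ = 1 := norm_intCast_eq_one_of_not_dvd h5lam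
  have hlq0 : padicLog 5 q ≠ 0 := by intro h; rw [h, norm_zero] at hlogn; norm_num at hlogn
  -- `w = L²/C² ≡ 25λ²/Γ (mod 5⁻³)`
  have hwdef : logUnitParamSq W 5 q x y = L ^ 2 / C2 := by rw [logUnitParamSq]
  set w := logUnitParamSq W 5 q x y with hwname
  have hw25 : ‖w - 25 * (lam : ℚ_[5]) ^ 2 / Γ‖ ≤ 1 / 125 := by
    have hid : w - 25 * (lam : ℚ_[5]) ^ 2 / Γ =
        ((Γ : ℚ_[5]) * (L ^ 2 - 25 * (lam : ℚ_[5]) ^ 2) + 25 * (lam : ℚ_[5]) ^ 2 * ((Γ : ℚ_[5]) - C2)) / (C2 * Γ) := by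
      rw [hwdef]; field_simp; ring
    rw [hid, norm_div, norm_mul, hC2, hΓn, one_mul, div_one]
    refine (IsUltrametricDist.norm_add_le_max _ _).trans (max_le ?_ ?_)
    · rw [norm_mul, hΓn, one_mul]; exact hL2.trans (by norm_num)
    · rw [norm_mul, norm_mul, norm_twentyfive₅', norm_pow, hlamn, one_pow, mul_one, ← norm_neg ((Γ : ℚ_[5]) - C2), neg_sub]
      calc 1 / 25 * ‖C2 - Γ‖ ≤ 1 / 25 * (1 / 5) := by gcongr
        _ = 1 / 125 := by norm_num
  -- `T₂ = w / log₅ q ≡ 5τ₂ (mod 5⁻²)`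
  have hT2 : ‖w / padicLog 5 q - 5 * (τ₂ : ℚ_[5])‖ ≤ 1 / 25 := by
    have hnumid : (w - 25 * (lam : ℚ_[5]) ^ 2 / Γ) + (-(25 * (((Γ * μ * τ₂ - lam ^ 2 : ℤ)) : ℚ_[5])) / Γ) +
          5 * (τ₂ : ℚ_[5]) * (5 * (μ : ℚ_[5]) - padicLog 5 q) = w - 5 * (τ₂ : ℚ_[5]) * padicLog 5 q := by
      push_cast; field_simp; ring
    have hid : w / padicLog 5 q - 5 * (τ₂ : ℚ_[5]) =
        ((w - 25 * (lam : ℚ_[5]) ^ 2 / Γ) + (-(25 * (((Γ * μ * τ₂ - lam ^ 2 : ℤ)) : ℚ_[5])) / Γ) +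
          5 * (τ₂ : ℚ_[5]) * (5 * (μ : ℚ_[5]) - padicLog 5 q)) / padicLog 5 q := by
      rw [hnumid]; field_simp
    rw [hid, norm_div, hlogn]
    have hnum : ‖(w - 25 * (lam : ℚ_[5]) ^ 2 / Γ) + (-(25 * (((Γ * μ * τ₂ - lam ^ 2 : ℤ)) : ℚ_[5])) / Γ) +
        5 * (τ₂ : ℚ_[5]) * (5 * (μ : ℚ_[5]) - padicLog 5 q)‖ ≤ 1 / 125 := by
      refine (IsUltrametricDist.norm_add_le_max _ _).trans (max_le ?_ ?_)
      · refine (IsUltrametricDist.norm_add_le_max _ _).trans (max_le hw25 ?_)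
        rw [norm_div, norm_neg, norm_mul, norm_twentyfive₅', hΓn, div_one]
        calc 1 / 25 * ‖(((Γ * μ * τ₂ - lam ^ 2 : ℤ)) : ℚ_[5])‖ ≤ 1 / 25 * (1 / 5) := by
              gcongr
              exact ((Padic.norm_int_le_pow_iff_dvd (p := 5) _ 1).mpr (by simpa using hτ₂)).trans (by norm_num)
          _ = 1 / 125 := by norm_num
      · rw [norm_mul, norm_mul, norm_five₅', ← norm_neg (5 * (μ : ℚ_[5]) - padicLog 5 q), neg_sub]
        calc 1 / 5 * ‖(τ₂ : ℚ_[5])‖ * ‖padicLog 5 q - 5 * (μ : ℚ_[5])‖ ≤ 1 / 5 * 1 * (1 / 25) := by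
              gcongr; exact Padic.norm_int_le_one _
          _ = 1 / 125 := by norm_num
    calc ‖(w - 25 * (lam : ℚ_[5]) ^ 2 / Γ) + (-(25 * (((Γ * μ * τ₂ - lam ^ 2 : ℤ)) : ℚ_[5])) / Γ) +
          5 * (τ₂ : ℚ_[5]) * (5 * (μ : ℚ_[5]) - padicLog 5 q)‖ / (1 / 5) ≤ (1 / 125) / (1 / 5) := by gcongr
      _ = 1 / 25 := by norm_num
  -- the assembly: `T₁ − T₂ = 5(τ₁ − τ₂) + O(5⁻²)`
  intro h0
  rw [heightSplitCoord, ← hwname] at h0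
  have hid : (5 : ℚ_[5]) * (((τ₁ - τ₂ : ℤ)) : ℚ_[5]) =
      -(heightFourOneCoord W 5 q x y - 5 * (τ₁ : ℚ_[5])) + (w / padicLog 5 q - 5 * (τ₂ : ℚ_[5])) := by
    push_cast; linear_combination h0
  have hle : ‖(5 : ℚ_[5]) * (((τ₁ - τ₂ : ℤ)) : ℚ_[5])‖ ≤ 1 / 25 := by
    rw [hid]
    refine (IsUltrametricDist.norm_add_le_max _ _).trans (max_le ?_ hT2)
    rw [norm_neg]; exact hT1
  have hdvd : (5 : ℤ) ^ 1 ∣ τ₁ - τ₂ := by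
    refine (Padic.norm_int_le_pow_iff_dvd (p := 5) _ 1).mp ?_
    rw [norm_mul, norm_five₅'] at hle
    have : ‖(((τ₁ - τ₂ : ℤ)) : ℚ_[5])‖ ≤ 1 / 5 := by linarith
    simpa using this
  exact hcert (by simpa using hdvd)

/-- **`RegMult.CertSplit W 5 Q 1` from a first-order depth-one SPLIT certificate** (one bundled integer hypothesis `H`, decided per row
by `norm_num` — the depth-one data, the gcd reduction test, `Γ`, `τ₁`, the `j`-invariant as `c₄³/(5^δΔ')` with `δ ≥ 2`, `μ`, `τ₂`, and
**`5 ∤ τ₁ − τ₂`**): `Q = 1 • Q` is admissible at `5` and the MODIFIED §4.2 height of `Q` is non-zero at every Tate datum. Per curve; nothing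
class-wide. [cite: SteinWuthrich2013, §4.2 (p. 16)] [cite: MazurSteinTate2006, §1] -/
theorem certSplit_of_certDepthOne [W.IsElliptic] [W.IsGloballyMinimal] {a b c4 c6 lam Γ τ₁ μ τ₂ Dp : ℤ} {e' δ n : ℕ}
    (H : c4 = (a₁ ^ 2 + 4 * a₂) ^ 2 - 24 * (2 * a₄ + a₁ * a₃) ∧
      c6 = -(a₁ ^ 2 + 4 * a₂) ^ 3 + 36 * (a₁ ^ 2 + 4 * a₂) * (2 * a₄ + a₁ * a₃) - 216 * (a₃ ^ 2 + 4 * a₆) ∧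
      ¬ (5 : ℤ) ∣ c4 ∧ ¬ (5 : ℤ) ∣ c6 ∧ ¬ (5 : ℤ) ∣ e' ∧ ¬ (5 : ℤ) ∣ b ∧ Nat.Coprime a.natAbs (5 * e') ∧
      Int.gcd (2 * b + a₁ * a * (5 * e' : ℕ) + a₃ * (5 * e' : ℕ) ^ 3)
        (a₁ * b * (5 * e' : ℕ) - (3 * a ^ 2 + 2 * a₂ * a * (5 * e' : ℕ) ^ 2 + a₄ * (5 * e' : ℕ) ^ 4)) ∣ (5 * e') ^ n ∧
      (25 : ℤ) ∣ -2 * a * e' * b + 5 * a₁ * a ^ 2 * e' ^ 2 - 2 * lam * b ^ 2 ∧ ¬ (5 : ℤ) ∣ lam ∧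
      (5 : ℤ) ∣ c4 + Γ * c6 ∧ (25 : ℤ) ∣ (lam ^ 8 - (e' : ℤ) ^ 8) + 20 * (e' : ℤ) ^ 8 * τ₁ ∧
      2 ≤ δ ∧ ¬ (5 : ℤ) ∣ Dp ∧ (25 : ℤ) ∣ (Dp ^ 4 - c4 ^ 12) - 20 * c4 ^ 12 * μ ∧ ¬ (5 : ℤ) ∣ μ ∧
      (5 : ℤ) ∣ Γ * μ * τ₂ - lam ^ 2 ∧ ¬ (5 : ℤ) ∣ τ₁ - τ₂)
    (hj : W.j = ((c4 ^ 3 : ℤ) : ℚ) / ((5 ^ δ * Dp : ℤ) : ℚ))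
    {x y : ℚ} (hx : x = a / ((5 * e' : ℕ) : ℚ) ^ 2) (hy : y = b / ((5 * e' : ℕ) : ℚ) ^ 3)
    (h : W.toAffine.Nonsingular x y) : RegMult.CertSplit W 5 (.some x y h) 1 := by
  obtain ⟨hc4, hc6, h5c4, h5c6, h5e, h5b, hcop, hgcd, hlam, h5lam, hΓ, hτ₁, hδ, h5Dp, hμ, h5μ, hτ₂, hcert⟩ := H
  have he'0 : e' ≠ 0 := by rintro rfl; exact h5e (by simp)
  have he0 : (5 * e' : ℕ) ≠ 0 := by positivity
  have hx1 : 1 < ‖(x : ℚ_[5])‖ :=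
    (one_lt_norm_ratCast_iff 5 x).mpr (KernelCert.padicValRat_x_neg he0 hx hcop (dvd_mul_right 5 e'))
  have hadm : W.IsAdmissible 5 (.some x y h) :=
    isAdmissible_of_one_lt_norm (by norm_num) h hx1 (KernelCert.hasNonsingularReductionAt_of_gcd W hW he0 hx hy hcop hgcd)
  refine ⟨by rw [one_smul]; exact hadm, fun Dq => ?_⟩
  rw [one_smul]
  exact heightSplitCoord_ne_zero_of_certDepthOne W hW hc4 hc6 h5c4 h5c6 h5e h5b hcop hx hy hlam h5lam hΓ hτ₁ hj hδ h5Dp hμ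
    h5μ hτ₂ hcert Dq.norm_q_lt_one Dq.tateJ_eq

end Split

/-- **Both halves: `ClassClosure.RegulatorNonvanishingAt W 5` at a SPLIT pair, modulo GZK.** If `(x, y)` lies on `W` and every rendering
of that point carries a non-split certificate `RegMult.CertNonsplit W 5 Q 1` AND a split certificate `RegMult.CertSplit W 5 Q 1`, then
`ClassX11b W 5 → ClassClosure.RegulatorNonvanishingAt W 5` (`RegMult.regulatorNonvanishingAt_of_certs` at Mordell–Weil rank one from GZK).
ONE curve; Schneider class-wide asserted nowhere. [cite: SteinWuthrich2013, §4.2 and Conj. 4.1] [cite: KolyvaginEulerSystems1990, Thm. A] -/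
theorem regulatorNonvanishingAt_of_certs_of_GZK (hGZK : rank_eq_analyticRank_of_analyticRank_le_one)
    (W : WeierstrassCurve ℚ) [W.IsElliptic] [W.IsGloballyMinimal] {x y : ℚ} (hP : W.toAffine.Equation x y)
    (hc : ∀ h : W.toAffine.Nonsingular x y, RegMult.CertNonsplit W 5 (.some x y h) 1)
    (hc' : ∀ h : W.toAffine.Nonsingular x y, RegMult.CertSplit W 5 (.some x y h) 1)
    (hX : ClassX11b W 5) : ClassClosure.RegulatorNonvanishingAt W 5 :=
  RegMult.regulatorNonvanishingAt_of_certs W 5 (mordellWeilRank_eq_one_of_analyticRank hGZK hX.1)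
    (hc ((WeierstrassCurve.Affine.equation_iff_nonsingular (W := W.toAffine)).mp hP))
    (hc' ((WeierstrassCurve.Affine.equation_iff_nonsingular (W := W.toAffine)).mp hP))

end Summit.BirchSwinnertonDyer.Rank1Residual.X11b.RegMult.KernelCertFive
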